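import Summits.BirchSwinnertonDyer.BirchSwinnertonDyer.Theorems.PrintCf2RamifiedOffTYZSelmerRankOneSixGenus
import Summits.BirchSwinnertonDyer.Rank1Residual.P2.CongruentNumberPairsAtTwoTable
import Literature.NumberTheory.EllipticCurves.TianYuanZhang2017.CMPointFrobeniusFourDisplays
import Mathlib.Tactic.NormNum.LegendreSymbol
import HarnessLib

/-!
# Crux `PrintCf2.RamifiedOffTYZOfFacts` (stmt-BirchSwinnertonDyer-20509), line `offtyz-v7`, LEAD cycle 10 (cruxlead-20509 g9):
# THE FIRST NEW CURVE — `E_30 : y² = x³ − 900x` (conductor `7200 ≥ 5000`, in the crux's residual, OFF Tian–Yuan–Zhang's Thm 1.2 family: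
# `Σ₂′(30) = g(2)g(15) + g(30) = 2` is even) — `BSD(E_30, 2)` from the two printed facts ALONE (programme F3, part VIII)

THEOREMS ONLY (no `def`, no named fact, no `sorry`), `--supports stmt-BirchSwinnertonDyer-20509`.  For `n = 30 = 2·3·5` every hypothesis of the pointed
genus form (`rankOne_sha_bsdp_two_of_card_selmer_eight_six_genus_at`, previous file) is DECIDED on explicit `𝔽₂`-tables of the Legendre data
(`(5/3) = (3/5) = −1`, `(2/3) = (2/5) = −1`, `(−1/3) = −1`, `(−1/5) = +1`; the table route of `Rank1Residual.P2.CongruentNumberPairsAtTwoTable`):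
* `#Sel⁽²⁾(E_30/ℚ) = 8`: Monsky's even matrix `[[Aᵀ+D₂, D₋₁],[D₂, A+D₂]]` on `Fin 2 ⊕ Fin 2` has a two-element kernel (`decide`), and Monsky's exact
  formula (tree theorem) reads `#Sel₂ = 4·#ker`;
* the Selmer class `u = (0, 1; 1, 0)` has `u_{inl 1} = 1` at the prime `5` (`decide` on `kerSum`);
* the only block `S ∋ 5` of odd sign is `S = {3, 5}` (`d_S = 15 ≡ 3 (4)`; `{5}` has sign `(−1/5)₊ = 0`), i.e. the full block `2d_S = 30`, whose
  class-number parity `g(30) = #2Cl(ℚ(√−30))` is ODD because `det(A + D₂) = det [[0,1],[1,0]] = 1` (Smith's Table 1 row `n ≡ 2 (4)` via the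
  discharged Rédei–Reichardt theorem; indeed `Cl(ℚ(√−30)) ≅ (ℤ/2)²`).
Hence, granted `tyz_cmPointRingClassFrobeniusFourData` (TYZ §3 displays + the conductor-`4` Frobenius clause, p710393) and `thm11_parity_of_scriptL`
(TYZ Thm 1.1): `ord_{s=1} L(E_30, s) = 1`, `rank E_30(ℚ) = 1`, `Ш(E_30/ℚ)[2^∞] = 0`, `BSD(E_30, 2)` — and `BSD(W, 2)` for every globally minimal `W`
isogenous to `E_30` granted conjuncts 1–3 of 𝔅_ram.  (`30 = 5·12/2` is the area of the `(5, 12, 13)` triangle; the smallest even square-free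
`n ≡ 6 (mod 8)` with `s(n) = 1` outside TYZ's parity family, LEAD g9 instrument `find_examples.py`; next: `70, 174, 182, 230, 286, …`.)
BSD is not proved by any of this; no class is closed by this file (a conditional result toward item 23432 `RamifiedOffJumpOneOfFacts`).

References: [cite: TianYuanZhang2017, Thm. 1.1, Thm. 1.2, §3.1, Prop. 3.2 (2), Thm. 3.5, Thm. 3.6 (2), Lemma 3.18, proof of Lemma 3.21];
[cite: HeathBrown1994SelmerCongruentII, Appendix (Monsky), typescript p. 41 L20–L36]; [cite: Smith2016CongruentDensity, §2 Table 1, Thm. 1.2];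
[cite: LiMa2008, Thm. 0.4, Example 0.5]; [cite: Miller2011LMS, Def. 1.1]; [cite: MilneADT2006, Thm. I.7.3].
-/

noncomputable section

open scoped Classical NumberField

open WeierstrassCurve WeierstrassCurve.Affine Finset Matrix Literature.NumberTheory.EllipticCurves
  Literature.NumberTheory.EllipticCurves.TianYuanZhang2017
  Literature.NumberTheory.EllipticCurves.TianYuanZhang2017.W2
  Literature.NumberTheory.EllipticCurves.HeathBrown1994
  Literature.NumberTheory.EllipticCurves.HeathBrown1994.Families
  Literature.NumberTheory.EllipticCurves.Smith2016
  Literature.NumberTheory.EllipticCurves.MonskySelmerParity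
  Literature.NumberTheory.EllipticCurves.Rank1Residual
  Literature.NumberTheory.QuadraticFields.RingClass
  Literature.NumberTheory.QuadraticFields
  Summit.BirchSwinnertonDyer.Rank1Residual.P2
  Summit.BirchSwinnertonDyer.Rank1Residual.P2.GenusPeriodTransferLayer
  Summit.BirchSwinnertonDyer.PrintCf2.QForm

set_option autoImplicit false

namespace Summit.BirchSwinnertonDyer.PrintCf2.MoverAssembly

/-! ## §1 `#Sel₂ = 8` from a two-element kernel of Monsky's even matrix -/

/-- **`#ker M_even = 2 ⟹ #Sel₂(E_{2m}) = 8`** (converse reading of `card_ker_monskyEven_eq_two_of_card_selmer_eight`): Monsky's exact even formula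
`#Sel₂ = 2^{2+s}`, `s = 2k − rank M_even`, and `#ker = 2^{2k − rank}`. [cite: HeathBrown1994SelmerCongruentII, Appendix (Monsky), typescript p. 38 L17 – p. 41 L36] -/
theorem card_selmer_eq_eight_of_card_ker_monskyEven_eq_two {k : ℕ} (p : Fin k → ℕ) (hp : ∀ i, (p i).Prime) (hodd : ∀ i, Odd (p i))
    (hinj : Function.Injective p) (hker : Fintype.card {v : Fin k ⊕ Fin k → ZMod 2 // monskyMatrixEven p *ᵥ v = 0} = 2) :
    Nat.card ((congruentNumberCurve (2 * ∏ i, p i)).selmerGroup 2) = 8 := by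
  rw [monsky_card_selmerGroup_two_even_holds k p hp hodd hinj, monskySelmerRankEven]
  rw [card_ker_mulVec_eq_pow, Fintype.card_sum, Fintype.card_fin, ← two_mul] at hker
  have hs : 2 * k - (monskyMatrixEven p).rank = 1 := by
    have := Nat.pow_right_injective le_rfl (hker.trans (pow_one 2).symm)
    exact this
  rw [hs]; norm_num

/-! ## §2 The Legendre data of `n = 30 = 2·3·5` as tables -/

/-- `(3, 5)` are primes. [cite: HeathBrown1994SelmerCongruentII, Appendix (Monsky), typescript p. 39 L7–L8] -/
theorem prime_p35 : ∀ i, ((![3, 5] : Fin 2 → ℕ) i).Prime := by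
  intro i; fin_cases i <;> norm_num

/-- `(3, 5)` are odd. [cite: HeathBrown1994SelmerCongruentII, Appendix (Monsky), typescript p. 39 L7–L8] -/
theorem odd_p35 : ∀ i, Odd ((![3, 5] : Fin 2 → ℕ) i) := by
  intro i; fin_cases i <;> decide

/-- `(3, 5)` is injective. [cite: HeathBrown1994SelmerCongruentII, Appendix (Monsky), typescript p. 39 L7–L8] -/
theorem injective_p35 : Function.Injective (![3, 5] : Fin 2 → ℕ) := by
  intro i j h; fin_cases i <;> fin_cases j <;> simp_all

/-- The additive Legendre table of `(3, 5)`: `(5/3)₊ = (3/5)₊ = 1` (and the unused diagonal `(3/3)₊ = (5/5)₊ = 1`).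
[cite: HeathBrown1994SelmerCongruentII, Appendix (Monsky), typescript p. 39 L10–L26] -/
theorem legendreTable_p35 : ∀ i j, addLegendreSym ((![3, 5] : Fin 2 → ℕ) j) ((![3, 5] : Fin 2 → ℕ) i) = (1 : Fin 2 → Fin 2 → ZMod 2) i j := by
  intro i j
  fin_cases i <;> fin_cases j <;> simp [addLegendreSym] <;> norm_num

/-- `(2/3)₊ = (2/5)₊ = 1`. [cite: HeathBrown1994SelmerCongruentII, Appendix (Monsky), typescript p. 39 L10–L13] -/
theorem twoTable_p35 : ∀ i, addLegendreSym 2 ((![3, 5] : Fin 2 → ℕ) i) = (![1, 1] : Fin 2 → ZMod 2) i := by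
  intro i; fin_cases i <;> simp [addLegendreSym] <;> norm_num

/-- `(−1/3)₊ = 1`, `(−1/5)₊ = 0`. [cite: HeathBrown1994SelmerCongruentII, Appendix (Monsky), typescript p. 39 L10–L13] -/
theorem negOneTable_p35 : ∀ i, addLegendreSym (-1) ((![3, 5] : Fin 2 → ℕ) i) = (![1, 0] : Fin 2 → ZMod 2) i := by
  intro i; fin_cases i <;> simp [addLegendreSym] <;> norm_num

/-- Monsky's even matrix of `30 = 2·3·5` as an explicit `𝔽₂`-matrix on `Fin 2 ⊕ Fin 2`.
[cite: HeathBrown1994SelmerCongruentII, Appendix (Monsky), typescript p. 41 L20–L36] -/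
theorem monskyMatrixEven_p35 : monskyMatrixEven (![3, 5] : Fin 2 → ℕ) =
    Matrix.fromBlocks
      ((Matrix.of (fun i j => if i = j then ∑ l ∈ Finset.univ.erase i, (1 : Fin 2 → Fin 2 → ZMod 2) i l else (1 : Fin 2 → Fin 2 → ZMod 2) i j))ᵀ +
        Matrix.diagonal ![1, 1])
      (Matrix.diagonal ![1, 0]) (Matrix.diagonal ![1, 1])
      (Matrix.of (fun i j => if i = j then ∑ l ∈ Finset.univ.erase i, (1 : Fin 2 → Fin 2 → ZMod 2) i l else (1 : Fin 2 → Fin 2 → ZMod 2) i j) +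
        Matrix.diagonal ![1, 1]) := by
  rw [monskyMatrixEven, legendreMatrix_eq_ofTable _ _ legendreTable_p35, legendreDiagonal_eq_ofTable _ 2 _ twoTable_p35,
    legendreDiagonal_eq_ofTable _ (-1) _ negOneTable_p35]

/-- **`#ker M_even(30) = 2`** (kernel `{0, (0,1;1,0)}`), by `decide` on the table. [cite: HeathBrown1994SelmerCongruentII, Appendix (Monsky), typescript p. 41 L20–L36] -/
theorem card_ker_monskyMatrixEven_p35 : Fintype.card {v : Fin 2 ⊕ Fin 2 → ZMod 2 // monskyMatrixEven (![3, 5] : Fin 2 → ℕ) *ᵥ v = 0} = 2 := by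
  rw [monskyMatrixEven_p35]
  decide

/-- **`#Sel⁽²⁾(E_30/ℚ) = 8`** (Monsky's exact formula, `s(30) = 1`). [cite: HeathBrown1994SelmerCongruentII, Appendix (Monsky), typescript p. 41 L20–L36] -/
theorem card_selmer_thirty : Nat.card ((congruentNumberCurve (2 * ∏ i, (![3, 5] : Fin 2 → ℕ) i)).selmerGroup 2) = 8 :=
  card_selmer_eq_eight_of_card_ker_monskyEven_eq_two _ prime_p35 odd_p35 injective_p35 card_ker_monskyMatrixEven_p35

/-- **The Selmer class of `E_30` points at the prime `5`**: `(kerSum M_even)_{inl 1} = 1`. [cite: HeathBrown1994SelmerCongruentII, Appendix (Monsky), typescript p. 41 L20–L36] -/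
theorem kerSum_monskyMatrixEven_p35_inl_one : kerSum (monskyMatrixEven (![3, 5] : Fin 2 → ℕ)) (Sum.inl 1) = 1 := by
  rw [monskyMatrixEven_p35]
  unfold kerSum
  decide

/-- **`g(30)` is odd** (`det(A + D₂) = det [[0,1],[1,0]] = 1`, Smith's Table 1 via Rédei–Reichardt; `Cl(ℚ(√−30)) ≅ (ℤ/2)²`).
[cite: Smith2016CongruentDensity, §2 Table 1 (row n ≡ 2 (4))] [cite: LiMa2008, Thm. 0.4] -/
theorem odd_gK_thirty : Odd (gK (2 * ∏ i, (![3, 5] : Fin 2 → ℕ) i)) := by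
  rw [gK, odd_genusClassNumber_genusField_two_mul_iff_det _ prime_p35 odd_p35 injective_p35,
    legendreMatrix_eq_ofTable _ _ legendreTable_p35, legendreDiagonal_eq_ofTable _ 2 _ twoTable_p35]
  decide

/-- The blocks through `5` of odd sign: only the full block (`{5}` has sign `(−1/5)₊ = 0`). [cite: HeathBrown1994SelmerCongruentII, Appendix (Monsky), typescript p. 39 L36–L37] -/
theorem blocks_through_five (S : Finset (Fin 2)) (h1 : (1 : Fin 2) ∈ S)
    (hS : (∑ j ∈ S, addLegendreSym (-1) ((![3, 5] : Fin 2 → ℕ) j)) = 1) : S = univ := by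
  have h0 : (0 : Fin 2) ∈ S := by
    by_contra h0
    have hS1 : S = {1} := by
      ext x; fin_cases x
      · simp only [Fin.zero_eta, Fin.isValue, mem_singleton, zero_ne_one, iff_false]; exact h0
      · simp only [Fin.mk_one, Fin.isValue, mem_singleton, iff_true]; exact h1
    rw [hS1, sum_singleton, negOneTable_p35] at hS
    exact zero_ne_one hS
  ext x; fin_cases x
  · simpa using h0
  · simpa using h1

/-! ## §3 `BSD(E_30, 2)` from the named facts -/

/-- **`E_30`, from the named facts.**  Granted `tyz_cmPointRingClassFrobeniusFourData` (TYZ §3 displays with the conductor-`4` Frobenius clause) and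
`thm11_parity_of_scriptL` (TYZ Thm 1.1): `ord_{s=1} L(E_30, s) = 1`, `rank E_30(ℚ) = 1`, `Ш(E_30/ℚ)[2^∞] = 0`, `BSD(E_30, 2)` — every other hypothesis of the
mover theorem `rankOne_sha_bsdp_two_of_card_selmer_eight_six` (pointed at `5`) is decided above (`#Sel₂(E_30) = 8`, the Selmer class points at `5`, `g(30)` odd). `E_30` (conductor `7200`) is the smallest member of
the `n ≡ 6 (mod 8)` minimal-Selmer stratum outside Tian–Yuan–Zhang's parity family (`Σ₂′(30)` even).
[cite: TianYuanZhang2017, Thm. 1.1, §3.1, Prop. 3.2 (2), Thm. 3.5, Thm. 3.6 (2), Lemma 3.18, proof of Lemma 3.21] [cite: Miller2011LMS, Def. 1.1] -/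
theorem rankOne_sha_bsdp_two_congruentNumberCurve_thirty_of_facts (hF : tyz_cmPointRingClassFrobeniusFourData) (h11 : thm11_parity_of_scriptL) :
    haveI := isElliptic_congruentNumberCurve (show (30 : ℕ) ≠ 0 by norm_num)
    (congruentNumberCurve 30).analyticRank = 1 ∧ (congruentNumberCurve 30).mordellWeilRank = 1 ∧
      AddCommGroup.primaryComponent (congruentNumberCurve 30).sha 2 = ⊥ ∧ BSDp (congruentNumberCurve 30) 2 := by
  have hn : (30 : ℕ) = 2 * ∏ i, (![3, 5] : Fin 2 → ℕ) i := by simp [Fin.prod_univ_two]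
  have hsq : Squarefree (30 : ℕ) := by
    rw [hn, ← prod_cons_two_eq]
    exact squarefree_prod_of_injective _ (prime_cons_two _ prime_p35) (injective_cons_two _ odd_p35 injective_p35)
  obtain ⟨D, hPr, hCM⟩ := hF 30 hsq (Or.inr (Or.inl (by norm_num)))
  obtain ⟨z, Φ, ΓH, ΓH', σ, θ, c, ρ₂, ρ₄, hc, hall⟩ := hCM
  obtain ⟨hLs, -, hrec, -, h35, -, -, -, h318, -, -⟩ := hPr
  have hsel : Nat.card ((congruentNumberCurve 30).selmerGroup 2) = 8 := by
    have h := card_selmer_thirty; rwa [← hn] at h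
  have hsel' : Nat.card ((congruentNumberCurve (2 * ∏ i, (![3, 5] : Fin 2 → ℕ) i)).selmerGroup 2) = 8 := card_selmer_thirty
  have hadj : (monskyMatrixEven (![3, 5] : Fin 2 → ℕ)).adjugate (Sum.inl 1) (Sum.inr 1) = 1 := by
    rw [adjugate_monskyEven_inl_inr_eq_kerSum _ prime_p35 odd_p35 injective_p35 hsel' 1, kerSum_monskyMatrixEven_p35_inl_one]
  have hgenus' : ∀ S : Finset (Fin 2), (1 : Fin 2) ∈ S → (∑ j ∈ S, addLegendreSym (-1) ((![3, 5] : Fin 2 → ℕ) j)) = 1 →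
      coblockWeight (![3, 5] : Fin 2 → ℕ) S = 1 →
      Odd (gK (2 * ∏ j ∈ S, (![3, 5] : Fin 2 → ℕ) j)) ∧
        Fintype.card {v : Fin S.card ⊕ Unit → ZMod 2 //
          (Matrix.fromBlocks (legendreMatrix (blockPrimes ![3, 5] S) + legendreDiagonal (blockPrimes ![3, 5] S) (-2))
            (Matrix.of fun j (_ : Unit) => addLegendreSym 2 (blockPrimes ![3, 5] S j))
            (0 : Matrix Unit (Fin S.card) (ZMod 2)) (0 : Matrix Unit Unit (ZMod 2))) *ᵥ v = 0} = 2 := by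
    intro S h1 hS _
    obtain rfl := blocks_through_five S h1 hS
    have hg : Odd (gK (2 * ∏ j ∈ (univ : Finset (Fin 2)), (![3, 5] : Fin 2 → ℕ) j)) := odd_gK_thirty
    refine ⟨hg, ?_⟩
    have hS' : (∑ t, addLegendreSym (-1) (blockPrimes (![3, 5] : Fin 2 → ℕ) univ t)) = 1 := by
      rw [← hS]
      simp only [blockPrimes_apply]
      rw [← sum_coe_sort (univ : Finset (Fin 2))]
      exact ((univ : Finset (Fin 2)).orderIsoOfFin rfl).toEquiv.sum_comp
        (fun x : {x // x ∈ (univ : Finset (Fin 2))} => addLegendreSym (-1) ((![3, 5] : Fin 2 → ℕ) (x : Fin 2)))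
    have hg' : Odd (gK (2 * ∏ t, blockPrimes (![3, 5] : Fin 2 → ℕ) univ t)) := by rw [prod_blockPrimes]; exact hg
    exact card_ker_blockN_eq_two_of_odd_gK (blockPrimes ![3, 5] univ) (blockPrimes_prime _ prime_p35 _) (blockPrimes_odd _ odd_p35 _)
      (blockPrimes_injective _ injective_p35 _) hS' hg'
  exact rankOne_sha_bsdp_two_of_card_selmer_eight_six (![3, 5] : Fin 2 → ℕ) prime_p35 odd_p35 injective_p35 D hn (by decide)
    hrec h35 hLs h318 z Φ ΓH ΓH' σ θ c hc
    (fun d hd => ⟨(hall d hd).1, (hall d hd).2.2.1⟩) (fun d hd h6d => (hall d hd).2.1 h6d)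
    (fun d hd h6d => (hall d hd).2.2.2.2.2.2 h6d) h11 1 hgenus' hadj hsel

/-- **`BSD(W, 2)` for every globally minimal `W/ℚ` isogenous to `E_30`**, granted the two printed TYZ facts and conjuncts 1–3 of 𝔅_ram (GZK, entire
`L`, Cassels). [cite: MilneADT2006, Thm. I.7.3] [cite: TianYuanZhang2017, Thm. 1.1 and §3] [cite: Miller2011LMS, Def. 1.1] -/
theorem bsdp_two_of_isIsogenous_congruentNumberCurve_thirty (hF : tyz_cmPointRingClassFrobeniusFourData) (h11 : thm11_parity_of_scriptL)
    (hGZK : rank_eq_analyticRank_of_analyticRank_le_one) (hL : hasEntireLFunction_rat) (hCassels : bsdRHS_eq_of_isIsogenous)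
    {W : WeierstrassCurve ℚ} [W.IsElliptic] [W.IsGloballyMinimal] (hiso : IsIsogenous W (congruentNumberCurve 30)) : BSDp W 2 := by
  have hsq : Squarefree (30 : ℕ) := by
    have hn : (30 : ℕ) = 2 * ∏ i, (![3, 5] : Fin 2 → ℕ) i := by simp [Fin.prod_univ_two]
    rw [hn, ← prod_cons_two_eq]
    exact squarefree_prod_of_injective _ (prime_cons_two _ prime_p35) (injective_cons_two _ odd_p35 injective_p35)
  haveI := isElliptic_congruentNumberCurve hsq.ne_zero
  haveI := isGloballyMinimal_congruentNumberCurve hsq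
  obtain ⟨hr1, -, -, h₀⟩ := rankOne_sha_bsdp_two_congruentNumberCurve_thirty_of_facts hF h11
  exact Wuthrich2014.bsdp_of_isIsogenous hCassels hiso (hGZK (congruentNumberCurve 30) hr1.le).2
    ((congruentNumberCurve 30).leadingLCoeff_ne_zero_holds (hL (congruentNumberCurve 30))) h₀

/-! ## §4 The second member: `E_70 : y² = x³ − 4900x` (conductor `39200`; `Σ₂′(70) = g(7)g(10) + g(70) = 2` even ⇒ off TYZ Thm 1.2)

Appended (LEAD g9, same session): the same table route for `n = 70 = 2·5·7` — `(7/5) = (5/7) = −1`, `(2/5) = −1`, `(2/7) = +1`, `(−1/5) = +1`,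
`(−1/7) = −1`; Monsky's even matrix has kernel `{0, (1,0;1,1)}` (so `#Sel₂(E_70) = 8` and the Selmer class points at `5`), the only block
through `5` of odd sign is the full one, and `g(70)` is odd (`det(A + D₂) = det [[0,1],[1,1]] = 1`; `Cl(ℚ(√−70)) ≅ (ℤ/2)²`). -/

/-- `(5, 7)` are primes. [cite: HeathBrown1994SelmerCongruentII, Appendix (Monsky), typescript p. 39 L7–L8] -/
theorem prime_p57 : ∀ i, ((![5, 7] : Fin 2 → ℕ) i).Prime := by
  intro i; fin_cases i <;> norm_num

/-- `(5, 7)` are odd. [cite: HeathBrown1994SelmerCongruentII, Appendix (Monsky), typescript p. 39 L7–L8] -/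
theorem odd_p57 : ∀ i, Odd ((![5, 7] : Fin 2 → ℕ) i) := by
  intro i; fin_cases i <;> decide

/-- `(5, 7)` is injective. [cite: HeathBrown1994SelmerCongruentII, Appendix (Monsky), typescript p. 39 L7–L8] -/
theorem injective_p57 : Function.Injective (![5, 7] : Fin 2 → ℕ) := by
  intro i j h; fin_cases i <;> fin_cases j <;> simp_all

/-- The additive Legendre table of `(5, 7)`: `(7/5)₊ = (5/7)₊ = 1` (and the unused diagonal `= 1`).
[cite: HeathBrown1994SelmerCongruentII, Appendix (Monsky), typescript p. 39 L10–L26] -/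
theorem legendreTable_p57 : ∀ i j, addLegendreSym ((![5, 7] : Fin 2 → ℕ) j) ((![5, 7] : Fin 2 → ℕ) i) = (1 : Fin 2 → Fin 2 → ZMod 2) i j := by
  intro i j
  fin_cases i <;> fin_cases j <;> simp [addLegendreSym] <;> norm_num

/-- `(2/5)₊ = 1`, `(2/7)₊ = 0`. [cite: HeathBrown1994SelmerCongruentII, Appendix (Monsky), typescript p. 39 L10–L13] -/
theorem twoTable_p57 : ∀ i, addLegendreSym 2 ((![5, 7] : Fin 2 → ℕ) i) = (![1, 0] : Fin 2 → ZMod 2) i := by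
  intro i; fin_cases i <;> simp [addLegendreSym] <;> norm_num

/-- `(−1/5)₊ = 0`, `(−1/7)₊ = 1`. [cite: HeathBrown1994SelmerCongruentII, Appendix (Monsky), typescript p. 39 L10–L13] -/
theorem negOneTable_p57 : ∀ i, addLegendreSym (-1) ((![5, 7] : Fin 2 → ℕ) i) = (![0, 1] : Fin 2 → ZMod 2) i := by
  intro i; fin_cases i <;> simp [addLegendreSym] <;> norm_num

/-- Monsky's even matrix of `70 = 2·5·7` as an explicit `𝔽₂`-matrix on `Fin 2 ⊕ Fin 2`.
[cite: HeathBrown1994SelmerCongruentII, Appendix (Monsky), typescript p. 41 L20–L36] -/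
theorem monskyMatrixEven_p57 : monskyMatrixEven (![5, 7] : Fin 2 → ℕ) =
    Matrix.fromBlocks
      ((Matrix.of (fun i j => if i = j then ∑ l ∈ Finset.univ.erase i, (1 : Fin 2 → Fin 2 → ZMod 2) i l else (1 : Fin 2 → Fin 2 → ZMod 2) i j))ᵀ +
        Matrix.diagonal ![1, 0])
      (Matrix.diagonal ![0, 1]) (Matrix.diagonal ![1, 0])
      (Matrix.of (fun i j => if i = j then ∑ l ∈ Finset.univ.erase i, (1 : Fin 2 → Fin 2 → ZMod 2) i l else (1 : Fin 2 → Fin 2 → ZMod 2) i j) +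
        Matrix.diagonal ![1, 0]) := by
  rw [monskyMatrixEven, legendreMatrix_eq_ofTable _ _ legendreTable_p57, legendreDiagonal_eq_ofTable _ 2 _ twoTable_p57,
    legendreDiagonal_eq_ofTable _ (-1) _ negOneTable_p57]

/-- **`#ker M_even(70) = 2`** (kernel `{0, (1,0;1,1)}`), by `decide` on the table. [cite: HeathBrown1994SelmerCongruentII, Appendix (Monsky), typescript p. 41 L20–L36] -/
theorem card_ker_monskyMatrixEven_p57 : Fintype.card {v : Fin 2 ⊕ Fin 2 → ZMod 2 // monskyMatrixEven (![5, 7] : Fin 2 → ℕ) *ᵥ v = 0} = 2 := by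
  rw [monskyMatrixEven_p57]
  decide

/-- **`#Sel⁽²⁾(E_70/ℚ) = 8`** (Monsky's exact formula, `s(70) = 1`). [cite: HeathBrown1994SelmerCongruentII, Appendix (Monsky), typescript p. 41 L20–L36] -/
theorem card_selmer_seventy : Nat.card ((congruentNumberCurve (2 * ∏ i, (![5, 7] : Fin 2 → ℕ) i)).selmerGroup 2) = 8 :=
  card_selmer_eq_eight_of_card_ker_monskyEven_eq_two _ prime_p57 odd_p57 injective_p57 card_ker_monskyMatrixEven_p57

/-- **The Selmer class of `E_70` points at the prime `5`**: `(kerSum M_even)_{inl 0} = 1`. [cite: HeathBrown1994SelmerCongruentII, Appendix (Monsky), typescript p. 41 L20–L36] -/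
theorem kerSum_monskyMatrixEven_p57_inl_zero : kerSum (monskyMatrixEven (![5, 7] : Fin 2 → ℕ)) (Sum.inl 0) = 1 := by
  rw [monskyMatrixEven_p57]
  unfold kerSum
  decide

/-- **`g(70)` is odd** (`det(A + D₂) = det [[0,1],[1,1]] = 1`; `Cl(ℚ(√−70)) ≅ (ℤ/2)²`). [cite: Smith2016CongruentDensity, §2 Table 1 (row n ≡ 2 (4))] [cite: LiMa2008, Thm. 0.4] -/
theorem odd_gK_seventy : Odd (gK (2 * ∏ i, (![5, 7] : Fin 2 → ℕ) i)) := by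
  rw [gK, odd_genusClassNumber_genusField_two_mul_iff_det _ prime_p57 odd_p57 injective_p57,
    legendreMatrix_eq_ofTable _ _ legendreTable_p57, legendreDiagonal_eq_ofTable _ 2 _ twoTable_p57]
  decide

/-- The blocks of `70` through `5` of odd sign: only the full block (`{5}` has sign `(−1/5)₊ = 0`). [cite: HeathBrown1994SelmerCongruentII, Appendix (Monsky), typescript p. 39 L36–L37] -/
theorem blocks_through_five_seventy (S : Finset (Fin 2)) (h0 : (0 : Fin 2) ∈ S)
    (hS : (∑ j ∈ S, addLegendreSym (-1) ((![5, 7] : Fin 2 → ℕ) j)) = 1) : S = univ := by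
  have h1 : (1 : Fin 2) ∈ S := by
    by_contra h1
    have hS0 : S = {0} := by
      ext x; fin_cases x
      · simp only [Fin.zero_eta, Fin.isValue, mem_singleton, iff_true]; exact h0
      · simp only [Fin.mk_one, Fin.isValue, mem_singleton, one_ne_zero, iff_false]; exact h1
    rw [hS0, sum_singleton, negOneTable_p57] at hS
    exact zero_ne_one hS
  ext x; fin_cases x
  · simpa using h0
  · simpa using h1

/-- **`E_70`, from the named facts** (second member of the list `30, 70, 174, 182, 230, …` of LEAD g9's instrument): granted
`tyz_cmPointRingClassFrobeniusFourData` and `thm11_parity_of_scriptL`, `ord_{s=1} L(E_70, s) = 1`, `rank E_70(ℚ) = 1`, `Ш(E_70/ℚ)[2^∞] = 0`, `BSD(E_70, 2)`.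
[cite: TianYuanZhang2017, Thm. 1.1, §3.1, Prop. 3.2 (2), Thm. 3.5, Thm. 3.6 (2), Lemma 3.18, proof of Lemma 3.21] [cite: Miller2011LMS, Def. 1.1] -/
theorem rankOne_sha_bsdp_two_congruentNumberCurve_seventy_of_facts (hF : tyz_cmPointRingClassFrobeniusFourData) (h11 : thm11_parity_of_scriptL) :
    haveI := isElliptic_congruentNumberCurve (show (70 : ℕ) ≠ 0 by norm_num)
    (congruentNumberCurve 70).analyticRank = 1 ∧ (congruentNumberCurve 70).mordellWeilRank = 1 ∧
      AddCommGroup.primaryComponent (congruentNumberCurve 70).sha 2 = ⊥ ∧ BSDp (congruentNumberCurve 70) 2 := by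
  have hn : (70 : ℕ) = 2 * ∏ i, (![5, 7] : Fin 2 → ℕ) i := by simp [Fin.prod_univ_two]
  have hsq : Squarefree (70 : ℕ) := by
    rw [hn, ← prod_cons_two_eq]
    exact squarefree_prod_of_injective _ (prime_cons_two _ prime_p57) (injective_cons_two _ odd_p57 injective_p57)
  obtain ⟨D, hPr, hCM⟩ := hF 70 hsq (Or.inr (Or.inl (by norm_num)))
  obtain ⟨z, Φ, ΓH, ΓH', σ, θ, c, ρ₂, ρ₄, hc, hall⟩ := hCM
  obtain ⟨hLs, -, hrec, -, h35, -, -, -, h318, -, -⟩ := hPr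
  have hsel : Nat.card ((congruentNumberCurve 70).selmerGroup 2) = 8 := by
    have h := card_selmer_seventy; rwa [← hn] at h
  have hsel' : Nat.card ((congruentNumberCurve (2 * ∏ i, (![5, 7] : Fin 2 → ℕ) i)).selmerGroup 2) = 8 := card_selmer_seventy
  have hadj : (monskyMatrixEven (![5, 7] : Fin 2 → ℕ)).adjugate (Sum.inl 0) (Sum.inr 0) = 1 := by
    rw [adjugate_monskyEven_inl_inr_eq_kerSum _ prime_p57 odd_p57 injective_p57 hsel' 0, kerSum_monskyMatrixEven_p57_inl_zero]
  have hgenus' : ∀ S : Finset (Fin 2), (0 : Fin 2) ∈ S → (∑ j ∈ S, addLegendreSym (-1) ((![5, 7] : Fin 2 → ℕ) j)) = 1 →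
      coblockWeight (![5, 7] : Fin 2 → ℕ) S = 1 →
      Odd (gK (2 * ∏ j ∈ S, (![5, 7] : Fin 2 → ℕ) j)) ∧
        Fintype.card {v : Fin S.card ⊕ Unit → ZMod 2 //
          (Matrix.fromBlocks (legendreMatrix (blockPrimes ![5, 7] S) + legendreDiagonal (blockPrimes ![5, 7] S) (-2))
            (Matrix.of fun j (_ : Unit) => addLegendreSym 2 (blockPrimes ![5, 7] S j))
            (0 : Matrix Unit (Fin S.card) (ZMod 2)) (0 : Matrix Unit Unit (ZMod 2))) *ᵥ v = 0} = 2 := by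
    intro S h0 hS _
    obtain rfl := blocks_through_five_seventy S h0 hS
    have hg : Odd (gK (2 * ∏ j ∈ (univ : Finset (Fin 2)), (![5, 7] : Fin 2 → ℕ) j)) := odd_gK_seventy
    refine ⟨hg, ?_⟩
    have hS' : (∑ t, addLegendreSym (-1) (blockPrimes (![5, 7] : Fin 2 → ℕ) univ t)) = 1 := by
      rw [← hS]
      simp only [blockPrimes_apply]
      rw [← sum_coe_sort (univ : Finset (Fin 2))]
      exact ((univ : Finset (Fin 2)).orderIsoOfFin rfl).toEquiv.sum_comp
        (fun x : {x // x ∈ (univ : Finset (Fin 2))} => addLegendreSym (-1) ((![5, 7] : Fin 2 → ℕ) (x : Fin 2)))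
    have hg' : Odd (gK (2 * ∏ t, blockPrimes (![5, 7] : Fin 2 → ℕ) univ t)) := by rw [prod_blockPrimes]; exact hg
    exact card_ker_blockN_eq_two_of_odd_gK (blockPrimes ![5, 7] univ) (blockPrimes_prime _ prime_p57 _) (blockPrimes_odd _ odd_p57 _)
      (blockPrimes_injective _ injective_p57 _) hS' hg'
  exact rankOne_sha_bsdp_two_of_card_selmer_eight_six (![5, 7] : Fin 2 → ℕ) prime_p57 odd_p57 injective_p57 D hn (by decide)
    hrec h35 hLs h318 z Φ ΓH ΓH' σ θ c hc
    (fun d hd => ⟨(hall d hd).1, (hall d hd).2.2.1⟩) (fun d hd h6d => (hall d hd).2.1 h6d)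
    (fun d hd h6d => (hall d hd).2.2.2.2.2.2 h6d) h11 0 hgenus' hadj hsel

/-- **`BSD(W, 2)` for every globally minimal `W/ℚ` isogenous to `E_70`**, granted the two printed TYZ facts and conjuncts 1–3 of 𝔅_ram.
[cite: MilneADT2006, Thm. I.7.3] [cite: TianYuanZhang2017, Thm. 1.1 and §3] [cite: Miller2011LMS, Def. 1.1] -/
theorem bsdp_two_of_isIsogenous_congruentNumberCurve_seventy (hF : tyz_cmPointRingClassFrobeniusFourData) (h11 : thm11_parity_of_scriptL)
    (hGZK : rank_eq_analyticRank_of_analyticRank_le_one) (hL : hasEntireLFunction_rat) (hCassels : bsdRHS_eq_of_isIsogenous)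
    {W : WeierstrassCurve ℚ} [W.IsElliptic] [W.IsGloballyMinimal] (hiso : IsIsogenous W (congruentNumberCurve 70)) : BSDp W 2 := by
  have hsq : Squarefree (70 : ℕ) := by
    have hn : (70 : ℕ) = 2 * ∏ i, (![5, 7] : Fin 2 → ℕ) i := by simp [Fin.prod_univ_two]
    rw [hn, ← prod_cons_two_eq]
    exact squarefree_prod_of_injective _ (prime_cons_two _ prime_p57) (injective_cons_two _ odd_p57 injective_p57)
  haveI := isElliptic_congruentNumberCurve hsq.ne_zero
  haveI := isGloballyMinimal_congruentNumberCurve hsq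
  obtain ⟨hr1, -, -, h₀⟩ := rankOne_sha_bsdp_two_congruentNumberCurve_seventy_of_facts hF h11
  exact Wuthrich2014.bsdp_of_isIsogenous hCassels hiso (hGZK (congruentNumberCurve 70) hr1.le).2
    ((congruentNumberCurve 70).leadingLCoeff_ne_zero_holds (hL (congruentNumberCurve 70))) h₀

end Summit.BirchSwinnertonDyer.PrintCf2.MoverAssembly

end
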